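import Literature.NumberTheory.EllipticCurves.RootNumberAtkinLehner
import Literature.NumberTheory.EllipticCurves.RootNumberProductFormulaBCDTProofs
import Literature.NumberTheory.DiophantineGeometry.ConductorExponentZeroProofs
import Literature.NumberTheory.DiophantineGeometry.ConductorFactorizationProofs
import HarnessLib

/-!
# `ε(f_E) = ∏_p w_p(E)` and `w(E) = −∏_p w_p(E)` from Kellock–Dokchitser's Remark 2.2 and
Atkin–Lehner theory (proofs for `RootNumberAtkinLehner`)

A `…Proofs` sibling (theorems only). The local product formula for the Fricke sign,
`WeierstrassCurve.frickeEigenvalue_eq_finprod_localRootNumberAt` (`RootNumberProductFormulaProofs`: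
for an elliptic `W / ℚ` with no additive reduction above `2, 3` and `f ∈ S₂(Γ₀(N_W))` its newform,
`ε(f) = ∏ᶠ_v w_v(E)`), is **proved** here from

* (F1, deep) `WeierstrassCurve.atkinLehnerEigenvalueAt_eq_localRootNumberAt`
  (`RootNumberAtkinLehner`; Kellock–Dokchitser 2023, Rem. 2.2: at `p ∣ N_W` the Atkin–Lehner
  eigenvalue `λ(Q_p)(f)` is the local root number `w_p(E)` — local Langlands for `GL₂`, Schmidt
  2002 Thm. 3.2.2, modularity);
* (F2, classical) `IsNewform0.frickeEigenvalue_eq_prod_atkinLehnerEigenvalueAt` in weight `2` at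
  the single level `N_W` (`AtkinLehnerInvolutions`; Knapp 1993, Thm. 9.27(c): `ε(f) = ∏_{p ∣ N} λ(Q_p)`;
  proved from Thm. 9.27(b), and outright at squarefree level, in `AtkinLehnerProductProofs`);
* and the discharged classical facts `conductorExponent_eq_zero_iff_holds` (`f_v = 0 ↔` good
  reduction, Silverman ATAEC IV.10.2(a)), `factorization_conductorNorm_holds` (`N_W = ∏ p^{f_p}`)
  and `localRootNumberAt_of_hasGoodReductionAt` (`w_v = 1` at good `v`), which identify the support
  of `v ↦ w_v(E)` with the primes dividing `N_W` (`finprod_localRootNumberAt_eq_prod`).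

Consequently (`RootNumberProductFormulaBCDTProofs`) the named fact
`WeierstrassCurve.rootNumber_eq_algebraicRootNumber` — `w(E) = −∏_p w_p(E)` (Deligne 1973;
Rohrlich 1994, §20; Kellock–Dokchitser 2023, Def. 2.1) — holds for `W` from the Modularity Theorem
(`exists_isNewformOf`, BCDT 2001 Thm. A; or BCDT Thm. B + CDT Thm. 7.2.4), F1 and F2:
`rootNumber_eq_algebraicRootNumber_of_atkinLehner`,
`rootNumber_eq_algebraicRootNumber_of_theoremB_of_CDT_of_atkinLehner`. Its trust base in the tree
is thereby {modularity, Kellock–Dokchitser Rem. 2.2 at the primes `p ∣ N_E`, Knapp Thm. 9.27(c)},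
the last being classical (the product formula `w_N = ∏ w_Q`, Knapp Lemma 9.24), and Rem. 2.2 being
classical at `p ∥ N_E` (`λ(p) = −a_p`, `AtkinLehnerInvolutionsProofs`) and deep only at the additive
primes `p² ∣ N_E`.

## References

* [KellockDokchitser2023] L. Cowland Kellock, V. Dokchitser, Bull. LMS 55 (2023), Def. 2.1,
  Rem. 2.2, Thm. 2.3 (PDF pp. 7–8 of `paper:arxiv-2303.07883`).
* [Knapp1993] A. W. Knapp, *Elliptic curves* (1993), Lemma 9.24, Thm. 9.27 (PDF pp. 215–218).
* [BCDTJAMS2001] Breuil–Conrad–Diamond–Taylor, JAMS 14 (2001), Thm. A, Thm. B.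
* [Rohrlich1994CRM] D. Rohrlich, CRM Proc. Lecture Notes 4 (1994), §§19–20 (not held).
* [Silverman1994] J. H. Silverman, *Advanced Topics*, GTM 151, IV.10.2(a).
-/

noncomputable section

open scoped MatrixGroups

open CongruenceSubgroup Literature.NumberTheory.EllipticCurves.ModularForms IsDedekindDomain
  Literature.NumberTheory.Automorphic.BCDT Rat.HeightOneSpectrum

namespace WeierstrassCurve

variable (W : WeierstrassCurve ℚ)

/-- **Bad places divide the conductor**: if `w_v(E) ≠ 1` then the prime `p` under `v` divides
`N_W`, i.e. `p ∈ N_W.primeFactors` — `w_v = 1` at good `v` (Rohrlich 1993, Prop. 2(i)), `f_v = 0 ↔`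
good reduction (`conductorExponent_eq_zero_iff_holds`, Silverman ATAEC IV.10.2(a)) and
`v_p(N_W) = f_v` (`factorization_conductorNorm_holds`). [cite: Silverman1994, IV.10.2(a)] -/
theorem natGenerator_mem_primeFactors_conductorNorm_of_localRootNumberAt_ne_one [W.IsElliptic]
    {v : HeightOneSpectrum ℤ} (hv : W.localRootNumberAt v ≠ 1) :
    natGenerator v ∈ (W.conductorNorm ℤ).primeFactors := by
  rw [← Nat.support_factorization, Finsupp.mem_support_iff, factorization_conductorNorm_holds W v]
  intro h0
  exact hv (localRootNumberAt_of_hasGoodReductionAt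
    ((conductorExponent_eq_zero_iff_holds v W).mp h0))

/-- **`∏ᶠ_v w_v(E) = ∏_{p ∣ N_W} w_p(E)`**: the product of the local root numbers over all finite
places of `ℚ` is the finite product over the primes dividing the conductor, the place under `p`
being `primesEquiv.symm p` (the support of `v ↦ w_v(E)` lies over `N_W.primeFactors`,
`natGenerator_mem_primeFactors_conductorNorm_of_localRootNumberAt_ne_one`; Kellock–Dokchitser 2023,
Def. 2.1 and Thm. 2.3(ii)). [cite: KellockDokchitser2023, Def. 2.1 and Thm. 2.3] -/
theorem finprod_localRootNumberAt_eq_prod [W.IsElliptic] :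
    ∏ᶠ v : HeightOneSpectrum ℤ, W.localRootNumberAt v =
      ∏ p ∈ (W.conductorNorm ℤ).primeFactors.attach,
        W.localRootNumberAt ((primesEquiv (R := ℤ)).symm ⟨p.1, Nat.prime_of_mem_primeFactors p.2⟩) := by
  classical
  set φ : {p // p ∈ (W.conductorNorm ℤ).primeFactors} → HeightOneSpectrum ℤ :=
    fun p ↦ (primesEquiv (R := ℤ)).symm ⟨p.1, Nat.prime_of_mem_primeFactors p.2⟩ with hφ
  have hφinj : Function.Injective φ := by
    intro p q h
    have h' := congrArg (fun v : HeightOneSpectrum ℤ ↦ ((primesEquiv v : Nat.Primes) : ℕ)) h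
    simp only [hφ, Equiv.apply_symm_apply] at h'
    exact Subtype.ext h'
  have hsupp : (Function.mulSupport fun v : HeightOneSpectrum ℤ ↦ W.localRootNumberAt v) ⊆
      ((W.conductorNorm ℤ).primeFactors.attach.image φ : Finset (HeightOneSpectrum ℤ)) := by
    intro v hv
    rw [Function.mem_mulSupport] at hv
    have hmem := W.natGenerator_mem_primeFactors_conductorNorm_of_localRootNumberAt_ne_one hv
    rw [Finset.coe_image]
    refine ⟨⟨natGenerator v, hmem⟩, by simp, ?_⟩
    rw [hφ, Equiv.symm_apply_eq]
    rfl
  rw [finprod_eq_prod_of_mulSupport_subset _ hsupp, Finset.prod_image fun p _ q _ h ↦ hφinj h]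

/-- **The local product formula for the Fricke sign from Kellock–Dokchitser's Remark 2.2 and
Atkin–Lehner's `ε(f) = ∏ λ(Q_p)`.** For an elliptic `W / ℚ` with no additive reduction above `2, 3`
and `f ∈ S₂(Γ₀(N_W))` its newform: `ε(f) = ∏_{p ∣ N_W} λ(Q_p)(f)` (F2, Knapp 1993 Thm. 9.27(c))
`= ∏_{p ∣ N_W} w_p(E)` (F1 at each `p ∣ N_W`, Kellock–Dokchitser 2023 Rem. 2.2; the guard `h23` of
the formula feeds the guard of F1) `= ∏ᶠ_v w_v(E)` (`finprod_localRootNumberAt_eq_prod`). This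
proves the named fact `W.frickeEigenvalue_eq_finprod_localRootNumberAt` of
`RootNumberProductFormulaProofs` from F1 and F2. [cite: KellockDokchitser2023, Rem. 2.2]
[cite: Knapp1993, Thm. 9.27(c)] -/
theorem frickeEigenvalue_eq_finprod_localRootNumberAt_of_atkinLehner
    (hF2 : ∀ [NeZero (W.conductorNorm ℤ)],
      IsNewform0.frickeEigenvalue_eq_prod_atkinLehnerEigenvalueAt
        (N := W.conductorNorm ℤ) (k := (2 : ℤ)))
    (hF1 : W.atkinLehnerEigenvalueAt_eq_localRootNumberAt) :
    W.frickeEigenvalue_eq_finprod_localRootNumberAt := by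
  intro _ _ h23 f hf
  rw [hF2 hf.1, W.finprod_localRootNumberAt_eq_prod, Int.cast_prod]
  conv_lhs => rw [← Finset.prod_attach]
  refine Finset.prod_congr rfl fun p _ ↦ ?_
  exact hF1 hf ⟨p.1, Nat.prime_of_mem_primeFactors p.2⟩ (Nat.dvd_of_mem_primeFactors p.2) (h23 _)

/-- **`w(E/ℚ) = −∏_p w_p(E)` from modularity, Kellock–Dokchitser's Remark 2.2 and Atkin–Lehner's
`ε(f) = ∏ λ(Q_p)`.** The named fact `W.rootNumber_eq_algebraicRootNumber` (Deligne 1973; Rohrlich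
1994, §20; Kellock–Dokchitser 2023, Def. 2.1 with Rem. 2.2) from the Modularity Theorem, Version `L`
(`exists_isNewformOf`, BCDT 2001 Thm. A; Diamond–Shurman Thm. 8.8.3), F1
(`atkinLehnerEigenvalueAt_eq_localRootNumberAt`) and F2 (Knapp 1993, Thm. 9.27(c)) in weight `2`:
`rootNumber_eq_algebraicRootNumber_of_exists_isNewformOf` (`RootNumberProductFormulaBCDTProofs`;
Hecke's functional equation and `ε(f) = ±1` are theorems of the tree) with the local product formula
supplied by `frickeEigenvalue_eq_finprod_localRootNumberAt_of_atkinLehner`.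
[cite: KellockDokchitser2023, Def. 2.1 and Rem. 2.2] [cite: Knapp1993, Thm. 9.27(c)] -/
theorem rootNumber_eq_algebraicRootNumber_of_atkinLehner (hmod : exists_isNewformOf)
    (hF2 : ∀ [NeZero (W.conductorNorm ℤ)],
      IsNewform0.frickeEigenvalue_eq_prod_atkinLehnerEigenvalueAt
        (N := W.conductorNorm ℤ) (k := (2 : ℤ)))
    (hF1 : W.atkinLehnerEigenvalueAt_eq_localRootNumberAt) :
    W.rootNumber_eq_algebraicRootNumber :=
  W.rootNumber_eq_algebraicRootNumber_of_exists_isNewformOf hmod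
    (W.frickeEigenvalue_eq_finprod_localRootNumberAt_of_atkinLehner hF2 hF1)

/-- **`w(E/ℚ) = −∏_p w_p(E)` from BCDT Theorem B, CDT Theorem 7.2.4, Kellock–Dokchitser's Remark 2.2
and Atkin–Lehner's `ε(f) = ∏ λ(Q_p)`**: the same with modularity supplied by
`exists_isNewformOf_of_theoremB_of_CDT` (`BCDTModularity`). This records the trust base
{BCDT Thm. B, CDT Thm. 7.2.4, F1 (Kellock–Dokchitser Rem. 2.2 at `p ∣ N_E`), F2 (Knapp Thm. 9.27(c))}
of `rootNumber_eq_algebraicRootNumber` in the tree.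
[cite: BCDTJAMS2001, Theorem 2.2.2 and Theorem A] [cite: KellockDokchitser2023, Def. 2.1 and Rem. 2.2] -/
theorem rootNumber_eq_algebraicRootNumber_of_theoremB_of_CDT_of_atkinLehner (hB : theoremB)
    (hCDT : CDT_theorem_7_2_4)
    (hF2 : ∀ [NeZero (W.conductorNorm ℤ)],
      IsNewform0.frickeEigenvalue_eq_prod_atkinLehnerEigenvalueAt
        (N := W.conductorNorm ℤ) (k := (2 : ℤ)))
    (hF1 : W.atkinLehnerEigenvalueAt_eq_localRootNumberAt) :
    W.rootNumber_eq_algebraicRootNumber :=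
  W.rootNumber_eq_algebraicRootNumber_of_atkinLehner (exists_isNewformOf_of_theoremB_of_CDT hB hCDT)
    hF2 hF1

/-- **`Λ(E, 2 − s) = w_alg Λ(E, s)` with `w_alg = −∏ᶠ_v w_v(E)`** for an elliptic `W / ℚ` with no
additive reduction above `2, 3`, from modularity (`exists_isNewformOf`), F1 and F2
(`hasFunctionalEquationSign_algebraicRootNumber_of_exists_isNewformOf` with the local product formula
from `frickeEigenvalue_eq_finprod_localRootNumberAt_of_atkinLehner`; Kellock–Dokchitser 2023,
Def. 2.1 and Rem. 2.2; Knapp 1993, Thm. 9.8 and Thm. 9.27). [cite: KellockDokchitser2023, Def. 2.1 and Rem. 2.2]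
[cite: Knapp1993, Thm. 9.8 and Thm. 9.27] -/
theorem hasFunctionalEquationSign_algebraicRootNumber_of_atkinLehner (hmod : exists_isNewformOf)
    (hF2 : ∀ [NeZero (W.conductorNorm ℤ)],
      IsNewform0.frickeEigenvalue_eq_prod_atkinLehnerEigenvalueAt
        (N := W.conductorNorm ℤ) (k := (2 : ℤ)))
    (hF1 : W.atkinLehnerEigenvalueAt_eq_localRootNumberAt) [W.IsElliptic]
    (h23 : ∀ v : HeightOneSpectrum ℤ, W.HasAdditiveReductionAt v → 3 < ringChar (ℤ ⧸ v.asIdeal)) :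
    W.HasFunctionalEquationSign W.algebraicRootNumber :=
  W.hasFunctionalEquationSign_algebraicRootNumber_of_exists_isNewformOf hmod
    (W.frickeEigenvalue_eq_finprod_localRootNumberAt_of_atkinLehner hF2 hF1) h23

end WeierstrassCurve

end
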